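import Mathlib
import Literature.Analysis.TotalPositivity.PolyaFrequencyReciprocal
import HarnessLib

/-!
# Totally nonnegative kernels on `ℕ × ℕ`: closure lemmas

Support file for the Sahi / Conjecture-P programme of route `PercNearOneGluingNoHeavy`
(`--supports stmt-CriticalPhenomena-4575`, prover prim-l12-p5 gen 35; proof note
`prim-l12-p5/PROOF-CONJECTURE-W-g35.md` §2–3).  No definitions, no named facts, no sorries.

A kernel `K : ℕ → ℕ → ℝ` is totally nonnegative (TN) when every minor
`det [K (r i) (c j)]_{i,j < k}` with strictly increasing `r, c : Fin k → ℕ` is `≥ 0`; "TN up to `N`" asks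
this for indices `< N` only.  Everything is stated with these quantifiers written out.  Contents:

* `det_kernel_scale` — minors of `u n · K n l · v l`;
* `stair_minor_nonneg` — the staircase kernel `[l ≤ n]` is TN (its minors are Toeplitz minors of the
  Pólya frequency sequence `(1,1,1,…)`: `Literature…isPolyaFrequencySeq_geometric`, ratio `1`);
  `ratioStair_minor_nonneg` — so is `[l ≤ n] · s n / s l` for `s > 0`;
* `mulLower_minor_nonneg` — `(n,l) ↦ Σ_{j ≤ n} A n j · B j l` is TN up to `N` when `A` is TN and lower
  triangular and `B` is TN up to `N` (Cauchy–Binet, `Literature…det_mul_eq_sum_strictMono`);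
* `blockOne_minor_nonneg` — the block kernel `1 ⊕ K` is TN up to `N + 1` when `K` is TN up to `N`.
-/

namespace Summit.CriticalPhenomena.PercolationContinuityZ3.Theorems

namespace TNKernel

open Finset Matrix

/-- Minors of a diagonally scaled kernel: `det[u(rᵢ) K(rᵢ,cⱼ) v(cⱼ)] = ∏u(rᵢ) · ∏v(cⱼ) · det[K(rᵢ,cⱼ)]`. -/
theorem det_kernel_scale (K : ℕ → ℕ → ℝ) (u v : ℕ → ℝ) {k : ℕ} (r c : Fin k → ℕ) :
    (Matrix.of fun i j => u (r i) * K (r i) (c j) * v (c j)).det =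
      (∏ i, u (r i)) * ((∏ j, v (c j)) * (Matrix.of fun i j => K (r i) (c j)).det) := by
  have h1 : (Matrix.of fun i j => u (r i) * K (r i) (c j) * v (c j)) =
      Matrix.of fun i j => (u ∘ r) i *
        ((Matrix.of fun i j => (v ∘ c) j * (Matrix.of fun i j => K (r i) (c j)) i j) i j) := by
    ext i j
    simp only [Matrix.of_apply, Function.comp]
    ring
  rw [h1, Matrix.det_mul_column, Matrix.det_mul_row]
  rfl

/-- The staircase kernel `(n,l) ↦ [l ≤ n]` is totally nonnegative: its minors are Toeplitz minors of
the Pólya frequency sequence `(1, 1, 1, …)`. -/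
theorem stair_minor_nonneg {k : ℕ} (r c : Fin k → ℕ) (hr : StrictMono r) (hc : StrictMono c) :
    0 ≤ (Matrix.of fun i j => if c j ≤ r i then (1 : ℝ) else 0).det := by
  have h := Literature.Analysis.TotalPositivity.isPolyaFrequencySeq_geometric
    (β := (1 : ℝ)) zero_le_one k r c hr hc
  have heq : Literature.Analysis.TotalPositivity.toeplitzMinor (fun n => (1 : ℝ) ^ n) r c =
      (Matrix.of fun i j => if c j ≤ r i then (1 : ℝ) else 0).det := by
    unfold Literature.Analysis.TotalPositivity.toeplitzMinor
    congr 1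
    ext i j
    simp only [Matrix.of_apply, Literature.Analysis.TotalPositivity.seqZ, one_pow]
    by_cases hij : c j ≤ r i
    · simp [hij]
    · simp [hij]
  rw [← heq]
  exact h

/-- The kernel `(n,l) ↦ [l ≤ n] · s n / s l` is totally nonnegative for every positive sequence `s`. -/
theorem ratioStair_minor_nonneg (s : ℕ → ℝ) (hs : ∀ n, 0 < s n) {k : ℕ} (r c : Fin k → ℕ)
    (hr : StrictMono r) (hc : StrictMono c) :
    0 ≤ (Matrix.of fun i j => if c j ≤ r i then s (r i) / s (c j) else 0).det := by
  have heq : (Matrix.of fun i j => if c j ≤ r i then s (r i) / s (c j) else 0) =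
      Matrix.of fun i j => s (r i) * (if c j ≤ r i then (1 : ℝ) else 0) * (s (c j))⁻¹ := by
    ext i j
    simp only [Matrix.of_apply]
    split_ifs
    · rw [mul_one, div_eq_mul_inv]
    · simp
  rw [heq, det_kernel_scale (fun n l => if l ≤ n then (1 : ℝ) else 0) s (fun l => (s l)⁻¹) r c]
  exact mul_nonneg (prod_nonneg fun i _ => (hs _).le)
    (mul_nonneg (prod_nonneg fun j _ => inv_nonneg.2 (hs _).le) (stair_minor_nonneg r c hr hc))

/-- **Products.**  If `A` is TN and lower triangular (`A n j = 0` for `j > n`) and `B` is TN up to `N`,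
then `(n,l) ↦ Σ_{j ≤ n} A n j · B j l` is TN up to `N` (Cauchy–Binet). -/
theorem mulLower_minor_nonneg (A B : ℕ → ℕ → ℝ) (N : ℕ)
    (hA : ∀ (k : ℕ) (r c : Fin k → ℕ), StrictMono r → StrictMono c →
      0 ≤ (Matrix.of fun i j => A (r i) (c j)).det)
    (hB : ∀ (k : ℕ) (r c : Fin k → ℕ), StrictMono r → StrictMono c → (∀ i, r i < N) → (∀ j, c j < N) →
      0 ≤ (Matrix.of fun i j => B (r i) (c j)).det)
    (htri : ∀ n j, n < j → A n j = 0)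
    {k : ℕ} (r c : Fin k → ℕ) (hr : StrictMono r) (hc : StrictMono c) (hrN : ∀ i, r i < N)
    (hcN : ∀ j, c j < N) :
    0 ≤ (Matrix.of fun i j => ∑ t ∈ range (r i + 1), A (r i) t * B t (c j)).det := by
  cases k with
  | zero => simp
  | succ k =>
    set R : ℕ := r (Fin.last k) + 1 with hR
    have hrR : ∀ i, r i < R := fun i => Nat.lt_succ_of_le (hr.monotone (Fin.le_last i))
    have hRN : R ≤ N := hrN (Fin.last k)
    let A' : Matrix (Fin (k + 1)) (Fin R) ℝ := Matrix.of fun i t => A (r i) t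
    let B' : Matrix (Fin R) (Fin (k + 1)) ℝ := Matrix.of fun t j => B t (c j)
    have hM : (Matrix.of fun i j => ∑ t ∈ range (r i + 1), A (r i) t * B t (c j)) = A' * B' := by
      ext i j
      rw [Matrix.mul_apply, Matrix.of_apply]
      have h1 : ∑ t ∈ range (r i + 1), A (r i) t * B t (c j) =
          ∑ t ∈ range R, A (r i) t * B t (c j) := by
        refine Finset.sum_subset (fun t ht => ?_) (fun t _ ht => ?_)
        · rw [mem_range] at ht ⊢
          exact lt_of_lt_of_le ht (hrR i)
        · rw [mem_range, not_lt] at ht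
          rw [htri (r i) t (by omega), zero_mul]
      rw [h1, ← Fin.sum_univ_eq_sum_range (fun t => A (r i) t * B t (c j)) R]
      rfl
    rw [hM, Literature.Analysis.TotalPositivity.det_mul_eq_sum_strictMono]
    refine Finset.sum_nonneg fun t ht => ?_
    rw [mem_filter] at ht
    have htm : StrictMono (fun j => ((t j : Fin R) : ℕ)) :=
      fun a b hab => Fin.lt_def.1 (ht.2 hab)
    refine mul_nonneg ?_ ?_
    · have : A'.submatrix id t = Matrix.of fun i j => A (r i) ((t j : Fin R) : ℕ) := by
        ext i j; rfl
      rw [this]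
      exact hA (k + 1) r (fun j => ((t j : Fin R) : ℕ)) hr htm
    · have : B'.submatrix t id = Matrix.of fun i j => B ((t i : Fin R) : ℕ) (c j) := by
        ext i j; rfl
      rw [this]
      exact hB (k + 1) (fun i => ((t i : Fin R) : ℕ)) c htm hc
        (fun i => lt_of_lt_of_le (t i).isLt hRN) hcN

/-- Shifting a strictly increasing selection of positive indices down by one. -/
theorem strictMono_sub_one {m : ℕ} (r : Fin m → ℕ) (hr : StrictMono r) (hpos : ∀ i, 0 < r i) :
    StrictMono (fun i => r i - 1) := by
  intro a b hab
  have := hr hab; have := hpos a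
  simp only
  omega

/-- **Blocks.**  If `K` is TN up to `N` then the block kernel `1 ⊕ K`,
`(n,l) ↦ [n = l = 0] + [n ≥ 1][l ≥ 1] K (n-1) (l-1)`, is TN up to `N + 1`. -/
theorem blockOne_minor_nonneg (K : ℕ → ℕ → ℝ) (N : ℕ)
    (hK : ∀ (k : ℕ) (r c : Fin k → ℕ), StrictMono r → StrictMono c → (∀ i, r i < N) → (∀ j, c j < N) →
      0 ≤ (Matrix.of fun i j => K (r i) (c j)).det)
    {k : ℕ} (r c : Fin k → ℕ) (hr : StrictMono r) (hc : StrictMono c) (hrN : ∀ i, r i < N + 1)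
    (hcN : ∀ j, c j < N + 1) :
    0 ≤ (Matrix.of fun i j =>
      if r i = 0 ∧ c j = 0 then (1 : ℝ) else if r i = 0 ∨ c j = 0 then 0 else K (r i - 1) (c j - 1)).det := by
  cases k with
  | zero => simp
  | succ k =>
    by_cases hr0 : r 0 = 0
    · by_cases hc0 : c 0 = 0
      · -- expand along row 0: only the corner survives
        have hcpos : ∀ j : Fin k, 0 < c j.succ := fun j => by
          have := hc (Fin.succ_pos j); omega
        have hrpos : ∀ i : Fin k, 0 < r i.succ := fun i => by
          have := hr (Fin.succ_pos i); omega
        rw [Matrix.det_succ_row_zero, Finset.sum_eq_single (0 : Fin (k + 1))]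
        · have hsub : (Matrix.of fun i j => if r i = 0 ∧ c j = 0 then (1 : ℝ) else
                if r i = 0 ∨ c j = 0 then 0 else K (r i - 1) (c j - 1)).submatrix Fin.succ
              (0 : Fin (k + 1)).succAbove =
              Matrix.of fun i j => K (r i.succ - 1) (c j.succ - 1) := by
            ext i j
            simp only [Matrix.submatrix_apply, Matrix.of_apply, Fin.succAbove_zero]
            have h1 := hrpos i; have h2 := hcpos j
            rw [if_neg (by omega), if_neg (by omega)]
          rw [hsub]
          simp only [Matrix.of_apply, hr0, hc0, and_self, if_true, Fin.val_zero, pow_zero, one_mul]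
          exact hK k (fun i => r i.succ - 1) (fun j => c j.succ - 1)
            (strictMono_sub_one _ (fun a b hab => hr (Fin.succ_lt_succ_iff.2 hab)) hrpos)
            (strictMono_sub_one _ (fun a b hab => hc (Fin.succ_lt_succ_iff.2 hab)) hcpos)
            (fun i => by have := hrN i.succ; have := hrpos i; omega)
            (fun j => by have := hcN j.succ; have := hcpos j; omega)
        · intro j _ hj
          have hcj : 0 < c j := by
            have := hc (Fin.pos_iff_ne_zero.2 hj); omega
          have hcj' : c j ≠ 0 := by omega
          have : (Matrix.of fun i j => if r i = 0 ∧ c j = 0 then (1 : ℝ) else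
              if r i = 0 ∨ c j = 0 then 0 else K (r i - 1) (c j - 1)) 0 j = 0 := by
            simp [Matrix.of_apply, hr0, hcj']
          rw [this]; ring
        · intro h; exact absurd (mem_univ _) h
      · -- row 0 vanishes
        have hcpos : ∀ j, 0 < c j := fun j => by
          have := hc.monotone (Fin.zero_le j); omega
        rw [Matrix.det_eq_zero_of_row_eq_zero (0 : Fin (k + 1))]
        intro j
        have hcj' : c j ≠ 0 := (hcpos j).ne'
        simp [Matrix.of_apply, hr0, hcj']
    · have hrpos : ∀ i, 0 < r i := fun i => by
        have := hr.monotone (Fin.zero_le i); omega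
      by_cases hc0 : c 0 = 0
      · -- column 0 vanishes
        rw [Matrix.det_eq_zero_of_column_eq_zero (0 : Fin (k + 1))]
        intro i
        have hri' : r i ≠ 0 := (hrpos i).ne'
        simp [Matrix.of_apply, hc0, hri']
      · have hcpos : ∀ j, 0 < c j := fun j => by
          have := hc.monotone (Fin.zero_le j); omega
        have heq : (Matrix.of fun i j => if r i = 0 ∧ c j = 0 then (1 : ℝ) else
              if r i = 0 ∨ c j = 0 then 0 else K (r i - 1) (c j - 1)) =
            Matrix.of fun i j => K (r i - 1) (c j - 1) := by
          ext i j
          simp only [Matrix.of_apply]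
          have h1 := hrpos i; have h2 := hcpos j
          rw [if_neg (by omega), if_neg (by omega)]
        rw [heq]
        exact hK (k + 1) _ _ (strictMono_sub_one r hr hrpos) (strictMono_sub_one c hc hcpos)
          (fun i => by have := hrN i; have := hrpos i; omega)
          (fun j => by have := hcN j; have := hcpos j; omega)

end TNKernel

end Summit.CriticalPhenomena.PercolationContinuityZ3.Theorems
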